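import Summits.QuantumFields.BalabanUV.Beta.GAN24.DeepFaceAntisymSpure

/-!
# `BalabanUV.Beta.GAN24.DeepFaceAntisymOfCurrentSym` — binder row G-an2-4 ∕ (CONV-C), TRANSFER-III («slot the chain», the OWNER gan24-p1's `TRANSFER-III-SIZING.v0_7.md` §3(a),
# second option; R-gan24p1-g46-2): **Part 50c's `hL ∕ hR` FOR ANY FIRST TABLE `S` CARRYING leaf-04's F5 LETTER** — MY Part 51 `DeepFaceAntisymSpure` §2–§3 RE-CUT OVER A GENERIC
# first table `S` with two displayed letters: (CS) the slot↔leg-symmetrised two-leg CLASS CURRENT of `S` vanishes (the SHAPE of leaf-04's `CurrentSymTower.sym_SpureRecAt`,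
# class data `c₁ Ψ₁ c₂ Ψ₂` supported on the `Lc`-faces) and (SP) parity-odd rows `trK (S κ u) = −sgnK (S κ u)`
# (G-an2-4 CRUX TEAM (2), leaf prover `b2b-balaban-gan24-formalise-leaf-02`, gen 78)

NOT IN PRINT; OUR BOOKKEEPING ([folklore] BY NAME over MY Part 51 §1 (`deepFace_eq_classDatum`, `abs_sawtooth_le`, `deepFace_supported`) and the unit calculus
`HessKerDressedUnits.unitS_apply ∕ legScale_inl`; 0 `def`, 0 cited fact, 0 `def … : Prop`, 0 sorry).
HONEST FRAMING (cell contract, verbatim): «discharging `BetaPertH` makes Bałaban's UV stability UNCONDITIONAL — a real constructive-QFT result; it is NOT the continuum limit and NOT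
the Clay problem.»  HONEST DEPENDENCY (verbatim): «continuum YM on T⁴ ⇐ BetaPertH ∧ nine spine estimates (0/9 proved); BetaPertH ⇐ (D1) ∧ (D4) ∧ CAP+tail; G-an2-4 gates asym, D1
and NE2/3/4.»

WHY.  `CombForcingPairForm` (this gen) proves road-P2's `hBF` SHAPE for the comb-chart forcing at row D1's literal of record (III′) GIVEN Part 50c's two deep-face antisymmetries `hL ∕ hR`
of `S̃′_i = unitS s_f s_m (SpureCombOf tabs … i)`.  At (E) MY Part 51 derived them from leaf-04's F5 (`sym_SpureRecAt`: the class-current symmetry of the pure table) and the table's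
parity; its proofs read `SpureRecAt` through those two letters only.  This file states them ONCE over the letters, so that leaf-04's (III′) twin of `sym_SpureRecAt` — the
class-current symmetry of `SpureCombOf` (NOT in the tree; leaf-04's first refusal) — is the ONE input left for `hBF` at (III′) (with (SP) = `trK_SpureCombOf`, in the tree).
* §1 **`deepFace_unitS_weightedFirst_of_currentSym`** (⟸ (CS)), §2 **`deepFace_unitS_freeFirst_of_currentSym`** (⟸ (CS)(SP)) — MY Part 51 §2–§3 token for token with `S` for `SpureRecAt … j`.
(E) is MY Part 51 (`hCS := sym_SpureRecAt`, `hSP := parityOdd_SpureRecAt`), NOT restated.  Asserts NO value of any table; leaf-04's F5 at (E) or (III′) is NOT re-derived or asserted;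
discharges NOTHING of (C) ∕ (C)sym ∕ `hBF` ∕ (Q-L) ∕ `(hS, hSall)` ∕ `(hW, hWall)`; NEVER «G-an2-4 closed» as (CONV-C); NOT D1, NOT `BetaPertH`, NOT continuum, NOT Clay.  2026-08-25.
-/

noncomputable section

open Finset
open scoped BigOperators
open Literature.MathematicalPhysics.QuantumFieldTheory
open Literature.MathematicalPhysics.QuantumFieldTheory.Balaban1983to89
open Literature.MathematicalPhysics.QuantumFieldTheory.Balaban1983to89.Beta
open ExpKernelCalculus (Site MKer)
open OneStepResolventKernel (Fib)
open Summit.QuantumFields.BalabanUV.Beta.TameKernelCalculus (trK trK_apply)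
open Summit.QuantumFields.BalabanUV.Beta.BorderedHessian (sgnK sgnK_apply sgnF sgnF_inl)
open Summit.QuantumFields.BalabanUV.Beta.HessKerDressedUnits (unitS unitS_apply legScale legScale_inl)
open Summit.QuantumFields.BalabanUV.Beta.GAN24.DeepFaceAntisymSpure (deepFace_eq_classDatum abs_sawtooth_le deepFace_supported)

namespace Summit.QuantumFields.BalabanUV.Beta.GAN24.DeepFaceAntisymOfCurrentSym

variable {d : ℕ} {Lc : ℕ} {S : Fin (d + 1) → Site (d + 1) → MKer (d + 1) (Fib d)}

/-! ## §1 Weighted leg first (`hL` of Part 50c) from the class-current symmetry letter (CS) -/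

/-- NOT IN PRINT; OUR BOOKKEEPING.  **DEEP-FACE ANTISYMMETRY, WEIGHTED LEG FIRST, FROM (CS)** (`hL` of Part 50c ∕ of `CombForcingPairForm` at any period `N`, `Lc ∣ N`, for ANY first table `S` whose
slot↔leg-symmetrised two-leg CLASS CURRENT vanishes — leaf-04's F5 letter `CurrentSymTower.sym_SpureRecAt`, DISPLAYED):
`Σ'_q [q_β]_N Σ'_u [u_ν]_N (unitS s_f s_m S) ν u q p (inl β) a + Σ'_q [q_ν]_N Σ'_u [u_β]_N (unitS …) β u q p (inl ν) a = 0` — MY Part 51 §2 token for token. -/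
theorem deepFace_unitS_weightedFirst_of_currentSym (hCS : ∀ (ν β : Fin (d + 1)) (c₁ : ℝ) (Ψ₁ : ℤ → ℝ) (B₁ : ℝ), (∀ s, |Ψ₁ s| ≤ B₁) → (∀ n : ℤ, n % (Lc : ℤ) ≠ (Lc : ℤ) - 1 → c₁ + (Ψ₁ (n + 1) - Ψ₁ n) = 0) →
      ∀ (c₂ : ℝ) (Ψ₂ : ℤ → ℝ) (B₂ : ℝ), (∀ s, |Ψ₂ s| ≤ B₂) → (∀ n : ℤ, n % (Lc : ℤ) ≠ (Lc : ℤ) - 1 → c₂ + (Ψ₂ (n + 1) - Ψ₂ n) = 0) →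
      ∀ (p : Site (d + 1)) (a : Fib d),
        (∑' q : Site (d + 1), (c₁ + (Ψ₁ (q β + 1) - Ψ₁ (q β))) * ∑' u : Site (d + 1), (c₂ + (Ψ₂ (u ν + 1) - Ψ₂ (u ν))) * S ν u q p (Sum.inl β) a) +
          ∑' q : Site (d + 1), (c₂ + (Ψ₂ (q ν + 1) - Ψ₂ (q ν))) * ∑' u : Site (d + 1), (c₁ + (Ψ₁ (u β + 1) - Ψ₁ (u β))) * S β u q p (Sum.inl ν) a = 0)
    (sf sm : ℝ) {N : ℕ} (hN : 1 ≤ N) (hLN : Lc ∣ N)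
    (ν β : Fin (d + 1)) (p : Site (d + 1)) (a : Fib d) :
    (∑' q : Site (d + 1), (if q β % (N : ℤ) = (N : ℤ) - 1 then (1 : ℝ) else 0) *
        ∑' u : Site (d + 1), (if u ν % (N : ℤ) = (N : ℤ) - 1 then (1 : ℝ) else 0) * unitS sf sm S ν u q p (Sum.inl β) a) +
      (∑' q : Site (d + 1), (if q ν % (N : ℤ) = (N : ℤ) - 1 then (1 : ℝ) else 0) *
        ∑' u : Site (d + 1), (if u β % (N : ℤ) = (N : ℤ) - 1 then (1 : ℝ) else 0) * unitS sf sm S β u q p (Sum.inl ν) a) = 0 := by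
  set Φ : ℤ → ℝ := fun n : ℤ => -((N : ℝ)⁻¹) * (((n % (N : ℤ) : ℤ) : ℝ)) with hΦ
  have hface : ∀ n : ℤ, (if n % (N : ℤ) = (N : ℤ) - 1 then (1 : ℝ) else 0) = (N : ℝ)⁻¹ + (Φ (n + 1) - Φ n) := fun n => deepFace_eq_classDatum hN n
  have hΦb : ∀ n, |Φ n| ≤ 1 := fun n => abs_sawtooth_le hN n
  have hff : ∀ n : ℤ, n % (Lc : ℤ) ≠ (Lc : ℤ) - 1 → (N : ℝ)⁻¹ + (Φ (n + 1) - Φ n) = 0 := fun n hn => deepFace_supported (Lc := Lc) hN hLN n hn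
  have hT := hCS ν β ((N : ℝ)⁻¹) Φ 1 hΦb hff ((N : ℝ)⁻¹) Φ 1 hΦb hff p a
  -- units: every entry picks up the common factor `(sf·sm)⁻¹·sf⁻¹·ℓ(a)`
  have eentry : ∀ (κ τ : Fin (d + 1)) (u q : Site (d + 1)), unitS sf sm S κ u q p (Sum.inl τ) a =
      ((sf * sm)⁻¹ * sf⁻¹ * legScale sf⁻¹ sm⁻¹ a) * S κ u q p (Sum.inl τ) a := by
    intro κ τ u q
    rw [unitS_apply, legScale_inl]
    ring
  have eterm : ∀ (κ τ : Fin (d + 1)), (∑' q : Site (d + 1), (if q τ % (N : ℤ) = (N : ℤ) - 1 then (1 : ℝ) else 0) *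
        ∑' u : Site (d + 1), (if u κ % (N : ℤ) = (N : ℤ) - 1 then (1 : ℝ) else 0) * unitS sf sm S κ u q p (Sum.inl τ) a) =
      ((sf * sm)⁻¹ * sf⁻¹ * legScale sf⁻¹ sm⁻¹ a) *
        ∑' q : Site (d + 1), ((N : ℝ)⁻¹ + (Φ (q τ + 1) - Φ (q τ))) * ∑' u : Site (d + 1), ((N : ℝ)⁻¹ + (Φ (u κ + 1) - Φ (u κ))) *
          S κ u q p (Sum.inl τ) a := by
    intro κ τ
    rw [← tsum_mul_left]
    refine tsum_congr fun q => ?_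
    rw [← hface (q τ)]
    have ein : ∑' u : Site (d + 1), (if u κ % (N : ℤ) = (N : ℤ) - 1 then (1 : ℝ) else 0) * unitS sf sm S κ u q p (Sum.inl τ) a =
        ((sf * sm)⁻¹ * sf⁻¹ * legScale sf⁻¹ sm⁻¹ a) * ∑' u : Site (d + 1), ((N : ℝ)⁻¹ + (Φ (u κ + 1) - Φ (u κ))) * S κ u q p (Sum.inl τ) a := by
      rw [← tsum_mul_left]
      refine tsum_congr fun u => ?_
      rw [← hface (u κ), eentry]
      ring
    rw [ein]
    ring
  rw [eterm ν β, eterm β ν, ← mul_add, hT, mul_zero]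

/-! ## §2 Free leg first (`hR` of Part 50c) from (CS) and the parity-odd rows (SP) -/

/-- NOT IN PRINT; OUR BOOKKEEPING.  **DEEP-FACE ANTISYMMETRY, FREE LEG FIRST, FROM (CS)(SP)** (`hR` of Part 50c at any period `N`, `Lc ∣ N`; the parity transposition at modulus `N`):
`Σ'_{s′} [s′_ν]_N Σ'_{t′} [t′_μ]_N (unitS s_f s_m S) μ t′ s s′ f (inl ν) + Σ'_{s′} [s′_μ]_N Σ'_{t′} [t′_ν]_N (unitS …) ν t′ s s′ f (inl μ) = 0` — MY Part 51 §3 token for token. -/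
theorem deepFace_unitS_freeFirst_of_currentSym (hCS : ∀ (ν β : Fin (d + 1)) (c₁ : ℝ) (Ψ₁ : ℤ → ℝ) (B₁ : ℝ), (∀ s, |Ψ₁ s| ≤ B₁) → (∀ n : ℤ, n % (Lc : ℤ) ≠ (Lc : ℤ) - 1 → c₁ + (Ψ₁ (n + 1) - Ψ₁ n) = 0) →
      ∀ (c₂ : ℝ) (Ψ₂ : ℤ → ℝ) (B₂ : ℝ), (∀ s, |Ψ₂ s| ≤ B₂) → (∀ n : ℤ, n % (Lc : ℤ) ≠ (Lc : ℤ) - 1 → c₂ + (Ψ₂ (n + 1) - Ψ₂ n) = 0) →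
      ∀ (p : Site (d + 1)) (a : Fib d),
        (∑' q : Site (d + 1), (c₁ + (Ψ₁ (q β + 1) - Ψ₁ (q β))) * ∑' u : Site (d + 1), (c₂ + (Ψ₂ (u ν + 1) - Ψ₂ (u ν))) * S ν u q p (Sum.inl β) a) +
          ∑' q : Site (d + 1), (c₂ + (Ψ₂ (q ν + 1) - Ψ₂ (q ν))) * ∑' u : Site (d + 1), (c₁ + (Ψ₁ (u β + 1) - Ψ₁ (u β))) * S β u q p (Sum.inl ν) a = 0)
    (hSP : ∀ (κ : Fin (d + 1)) (u : Site (d + 1)), trK (S κ u) = -sgnK (S κ u))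
    (sf sm : ℝ) {N : ℕ} (hN : 1 ≤ N) (hLN : Lc ∣ N)
    (μ ν : Fin (d + 1)) (s : Site (d + 1)) (f : Fib d) :
    (∑' s' : Site (d + 1), (if s' ν % (N : ℤ) = (N : ℤ) - 1 then (1 : ℝ) else 0) *
        ∑' t' : Site (d + 1), (if t' μ % (N : ℤ) = (N : ℤ) - 1 then (1 : ℝ) else 0) * unitS sf sm S μ t' s s' f (Sum.inl ν)) +
      (∑' s' : Site (d + 1), (if s' μ % (N : ℤ) = (N : ℤ) - 1 then (1 : ℝ) else 0) *
        ∑' t' : Site (d + 1), (if t' ν % (N : ℤ) = (N : ℤ) - 1 then (1 : ℝ) else 0) * unitS sf sm S ν t' s s' f (Sum.inl μ)) = 0 := by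
  set Φ : ℤ → ℝ := fun n : ℤ => -((N : ℝ)⁻¹) * (((n % (N : ℤ) : ℤ) : ℝ)) with hΦ
  have hface : ∀ n : ℤ, (if n % (N : ℤ) = (N : ℤ) - 1 then (1 : ℝ) else 0) = (N : ℝ)⁻¹ + (Φ (n + 1) - Φ n) := fun n => deepFace_eq_classDatum hN n
  have hΦb : ∀ n, |Φ n| ≤ 1 := fun n => abs_sawtooth_le hN n
  have hff : ∀ n : ℤ, n % (Lc : ℤ) ≠ (Lc : ℤ) - 1 → (N : ℝ)⁻¹ + (Φ (n + 1) - Φ n) = 0 := fun n hn => deepFace_supported (Lc := Lc) hN hLN n hn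
  -- the tower for the pure table, weighted leg first, free leg `(s, f)` second
  have hT := hCS μ ν ((N : ℝ)⁻¹) Φ 1 hΦb hff ((N : ℝ)⁻¹) Φ 1 hΦb hff s f
  -- parity transposition with units: every entry picks up the same factor
  have hpar := hSP
  have eentry : ∀ (κ τ : Fin (d + 1)) (t' s' : Site (d + 1)), unitS sf sm S κ t' s s' f (Sum.inl τ) =
      (-((sf * sm)⁻¹ * legScale sf⁻¹ sm⁻¹ f * sf⁻¹ * sgnF f)) * S κ t' s' s (Sum.inl τ) f := by
    intro κ τ t' s'
    rw [unitS_apply, legScale_inl]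
    have h := congrFun (congrFun (congrFun (congrFun (hpar κ t') s') s) (Sum.inl τ)) f
    rw [trK_apply] at h
    rw [h]
    simp only [Pi.neg_apply, sgnK_apply, sgnF_inl, one_mul]
    ring
  have eterm : ∀ (κ τ : Fin (d + 1)), (∑' s' : Site (d + 1), (if s' τ % (N : ℤ) = (N : ℤ) - 1 then (1 : ℝ) else 0) *
        ∑' t' : Site (d + 1), (if t' κ % (N : ℤ) = (N : ℤ) - 1 then (1 : ℝ) else 0) * unitS sf sm S κ t' s s' f (Sum.inl τ)) =
      (-((sf * sm)⁻¹ * legScale sf⁻¹ sm⁻¹ f * sf⁻¹ * sgnF f)) *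
        ∑' s' : Site (d + 1), ((N : ℝ)⁻¹ + (Φ (s' τ + 1) - Φ (s' τ))) * ∑' t' : Site (d + 1), ((N : ℝ)⁻¹ + (Φ (t' κ + 1) - Φ (t' κ))) *
          S κ t' s' s (Sum.inl τ) f := by
    intro κ τ
    rw [← tsum_mul_left]
    refine tsum_congr fun s' => ?_
    rw [← hface (s' τ)]
    have ein : ∑' t' : Site (d + 1), (if t' κ % (N : ℤ) = (N : ℤ) - 1 then (1 : ℝ) else 0) * unitS sf sm S κ t' s s' f (Sum.inl τ) =
        (-((sf * sm)⁻¹ * legScale sf⁻¹ sm⁻¹ f * sf⁻¹ * sgnF f)) * ∑' t' : Site (d + 1), ((N : ℝ)⁻¹ + (Φ (t' κ + 1) - Φ (t' κ))) * S κ t' s' s (Sum.inl τ) f := by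
      rw [← tsum_mul_left]
      refine tsum_congr fun t' => ?_
      rw [← hface (t' κ), eentry]
      ring
    rw [ein]
    ring
  rw [eterm μ ν, eterm ν μ, ← mul_add, hT, mul_zero]

end Summit.QuantumFields.BalabanUV.Beta.GAN24.DeepFaceAntisymOfCurrentSym

end
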